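import Summits.AnomalousDissipation.AnomalousDissipation.Theses.MomentParity
import Literature.Analysis.FluidPDE.LerayHopf

/-!
# Sketch — crux `ResolvedDissipation` (stmt-AnomalousDissipation-14284), crux-ideate round 1, ideator 1

First lemmas of the idea cards (signatures only; every constant is an existing declaration):

* card `galerkin-limit-energy-equality` — `FirstLemmaA` (the crux ⟺ mean energy EQUALITY of
  Galerkin-limit stationary laws; Prokhorov/portmanteau transfer), `MeanOnsagerCriterion`
  (CCFS-in-the-mean: a vanishing mean cubic Littlewood–Paley flux gives the equality),
  `GalerkinLimitIsSSS` (limits are Foias–Prodi stationary statistical solutions).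
* card `enstrophy-ui-level-ledger` — `FirstLemmaB` (the crux ⟺ N-uniform integrability of the
  enstrophy), `TruncatedPalinstrophy` (level-truncated Foias–Guillopé–Temam bound from polynomial
  stationarity), `LevelLedger` (energy transported across enstrophy levels).
* bracket remark `BridgeC` (uniform eventual absorption in `V` ⇒ the crux).
-/

open MeasureTheory Filter Topology
open scoped ENNReal InnerProductSpace

noncomputable section

namespace Summit.AnomalousDissipation.AnomalousDissipation.Cruxes.ResolvedDissipation.Sketch

open Literature.Analysis.FunctionSpaces Literature.Analysis.FluidPDE

local notation "𝕋³" => UnitAddTorus (Fin 3)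
local notation "E³" => EuclideanSpace ℝ (Fin 3)
local notation "H³" => Literature.Analysis.FunctionSpaces.Torus.energySpace (Fin 3)

/-- Spectral enstrophy `Z(u) = ‖∇u‖₂²` of `u ∈ H` (the crux's integrand). -/
def Z (u : H³) : ℝ≥0∞ :=
  Torus.eGradNormSq (u.1 : 𝕋³ → E³)

/-- Resolved enstrophy `‖∇P_K u‖₂²` (the crux's right-hand side). -/
def Zle (K : ℕ) (u : H³) : ℝ≥0∞ :=
  Torus.eGradNormSq (Torus.fourierTruncate K (u.1 : 𝕋³ → E³))

/-- Palinstrophy `|Au|² = 16π⁴ ∑ |k|⁴ |û(k)|²`. -/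
def Pal (u : H³) : ℝ≥0∞ :=
  ENNReal.ofReal (16 * Real.pi ^ 4) * Torus.eHomSobolevSeminorm 2 (EuclideanSpace.complexify ∘ (u.1 : 𝕋³ → E³)) ^ 2

/-- "carried by the level-`N` Fourier–Galerkin fields" (verbatim clause of the crux). -/
def IsLevel (N : ℕ) (v : 𝕋³ → E³) : Prop :=
  ∀ k ∉ (Torus.freqBall N).erase (0 : Fin 3 → ℤ), UnitAddTorus.mFourierCoeff (EuclideanSpace.complexify ∘ v) k = 0

/-- Stationarity against polynomial cylindrical band-limited observables (verbatim clause). -/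
def IsPolyStationary (ν : ℝ) (f : 𝕋³ → E³) (N : ℕ) (μ : Measure H³) : Prop :=
  ∀ (m : ℕ) (g : Fin m → 𝕋³ → E³) (P : MvPolynomial (Fin m) ℝ),
    (∀ i, (Torus.IsSmooth (g i) ∧ Torus.IsDivFree (g i) ∧ Torus.HasZeroMean (g i) ∧ IsLevel N (g i))) →
      Integrable (fun u => Torus.nsGeneratorPairing ν f u
        (fun x => ∑ i : Fin m, (MvPolynomial.eval (fun j => Torus.pairing u.1 (g j)) (MvPolynomial.pderiv i P)) • g i x)) μ ∧
      ∫ u, Torus.nsGeneratorPairing ν f u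
        (fun x => ∑ i : Fin m, (MvPolynomial.eval (fun j => Torus.pairing u.1 (g j)) (MvPolynomial.pderiv i P)) • g i x) ∂μ = 0

/-- The admissibility package of the crux at `(f, ν, R, N)`. -/
def CruxAdmissible (f : 𝕋³ → E³) (ν R : ℝ) (N : ℕ) (μ : Measure H³) : Prop :=
  IsProbabilityMeasure μ ∧ (∀ᵐ u ∂μ, IsLevel N (u.1 : 𝕋³ → E³)) ∧ (∀ᵐ u ∂μ, ‖u‖ ≤ R) ∧
    IsPolyStationary ν f N μ

/-- Smooth steady solenoidal mean-zero force. -/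
def IsGoodForce (f : 𝕋³ → E³) : Prop :=
  Torus.IsSmooth f ∧ Torus.IsDivFree f ∧ Torus.HasZeroMean f

/-! ## Card B — `enstrophy-ui-level-ledger` -/

/-- N-UNIFORM INTEGRABILITY of the enstrophy over all admissible laws at `(f, ν, R)`:
`sup_{N, μ} ∫_{Z > Λ} Z dμ → 0` as `Λ → ∞`. -/
def EnstrophyUI (f : 𝕋³ → E³) (ν R : ℝ) : Prop :=
  ∀ ε : ℝ≥0∞, 0 < ε → ∃ Λ : ℝ≥0∞, Λ < ∞ ∧ ∀ (N : ℕ) (μ : Measure H³), CruxAdmissible f ν R N μ →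
    ∫⁻ u in {u | Λ < Z u}, Z u ∂μ ≤ ε

/-- **First lemma (card B).** The crux is EQUIVALENT to N-uniform integrability of the enstrophy.
`←`: bounded energy forces `Z_{>K} ≥ Z/2` on `{Z > 8π²K²R²}`; `→`: `TruncatedPalinstrophy` +
Poincaré on the high modes + the UI tail. -/
def FirstLemmaB : Prop :=
  (∀ f, IsGoodForce f → ∀ ν : ℝ, 0 < ν → ∀ R : ℝ, EnstrophyUI f ν R) ↔
    Summit.AnomalousDissipation.AnomalousDissipation.Theses.MomentParity.ResolvedDissipation

/-- Level-truncated Foias–Guillopé–Temam bound (N-uniform): from stationarity against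
`φ(Z)` with `φ' = 1_{[0,Λ]}` smoothed and `|b(u,u,Au)| ≤ c ‖∇u‖^{3/2} |Au|^{3/2}`,
`∫_{Z ≤ Λ} |Au|² dμ ≤ C(f, ν, R, Λ)` for every admissible law, uniformly in `N`. -/
def TruncatedPalinstrophy : Prop :=
  ∀ f, IsGoodForce f → ∀ ν : ℝ, 0 < ν → ∀ (R : ℝ) (Λ : ℝ≥0∞), Λ < ∞ →
    ∃ C : ℝ≥0∞, C < ∞ ∧ ∀ (N : ℕ) (μ : Measure H³), CruxAdmissible f ν R N μ →
      ∫⁻ u in {u | Z u ≤ Λ}, Pal u ∂μ ≤ C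

/-- The generator applied to the enstrophy, `LZ(u) = 2[(f, Au) − ν|Au|² + ∫(u⊗u):∇(Au)]`
(vortex stretching written as `inertialPairing u (Au)`; `Au = −ΔP_N u` at level `N`). -/
def LZ (ν : ℝ) (f : 𝕋³ → E³) (N : ℕ) (u : H³) : ℝ :=
  2 * ((∫ x, ⟪f x, -(Torus.laplacian (Torus.fourierTruncate N (u.1 : 𝕋³ → E³)) x)⟫_ℝ) -
    ν * (Pal u).toReal +
      Torus.inertialPairing u.1 (fun x => -(Torus.laplacian (Torus.fourierTruncate N (u.1 : 𝕋³ → E³)) x)))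

/-- **Level ledger** (energy transported across enstrophy levels): for an admissible law and a
smooth bounded `g` whose derivative is compactly supported in `(0, ∞)`,
`ν ∫ Z g(Z) dμ = ∫ (f,u) g(Z) dμ + ∫ ½|u|² g'(Z) LZ dμ` — stationarity tested against the
non-polynomial observable `½|u|² g(Z)` (density upgrade on the compact support). With
`g ↑ 1_{(Λ,∞)}` the last term is the crossing intensity times the mean energy quantum. -/
def LevelLedger : Prop :=
  ∀ f, IsGoodForce f → ∀ ν : ℝ, 0 < ν → ∀ (R : ℝ) (N : ℕ) (μ : Measure H³), CruxAdmissible f ν R N μ →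
    ∀ g : ℝ → ℝ, ContDiff ℝ ⊤ g → HasCompactSupport (deriv g) → (∀ s ≤ 0, deriv g s = 0) →
      ν * ∫ u, (Z u).toReal * g (Z u).toReal ∂μ =
        (∫ u, Torus.pairing u.1 f * g (Z u).toReal ∂μ) +
          ∫ u, (2⁻¹ * ‖u‖ ^ 2) * deriv g (Z u).toReal * LZ ν f N u ∂μ

/-! ## Card A — `galerkin-limit-energy-equality` -/

/-- Mean energy EQUALITY for every weak limit (Prokhorov, norm topology of `H`) of admissible
laws at `(f, ν, R)`: `ν ∫ ‖∇u‖² dμ̄ = ∫ (f, u) dμ̄`. -/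
def GalerkinLimitEnergyEq (f : 𝕋³ → E³) (ν R : ℝ) : Prop :=
  ∀ (μs : ℕ → ProbabilityMeasure H³) (μbar : ProbabilityMeasure H³),
    (∀ i, ∃ N, CruxAdmissible f ν R N (μs i : Measure H³)) →
      Tendsto μs atTop (𝓝 μbar) →
        ν * (Torus.ensembleEnstrophy (μbar : Measure H³)).toReal =
          ∫ u, Torus.pairing u.1 f ∂(μbar : Measure H³)

/-- **First lemma (card A).** The crux is EQUIVALENT to the mean energy equality of Galerkin-limit
stationary laws (`←`: a leaking family is tight in the norm topology because `{‖u‖ ≤ R, Z ≤ M}` is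
compact and `μ(Z > M) ≤ ‖f‖R/(νM)`; portmanteau for the lsc `Z` and the continuous bounded
`Z ∘ P_K`, `(f, ·)` gives a limit with `ν⟨Z⟩ ≤ ⟨(f,u)⟩ − νδ`; `→`: the κ-clause passes
`⟨Z⟩` to the limit). -/
def FirstLemmaA : Prop :=
  (∀ f, IsGoodForce f → ∀ ν : ℝ, 0 < ν → ∀ R : ℝ, GalerkinLimitEnergyEq f ν R) ↔
    Summit.AnomalousDissipation.AnomalousDissipation.Theses.MomentParity.ResolvedDissipation

/-- Galerkin limits are Foias–Prodi stationary statistical solutions (Liouville equation and shell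
energy inequalities pass to the limit; FMRT 2001 Ch. IV). -/
def GalerkinLimitIsSSS : Prop :=
  ∀ f, IsGoodForce f → ∀ ν : ℝ, 0 < ν → ∀ (R : ℝ) (μs : ℕ → ProbabilityMeasure H³) (μbar : ProbabilityMeasure H³),
    (∀ i, ∃ N, CruxAdmissible f ν R N (μs i : Measure H³)) → Tendsto μs atTop (𝓝 μbar) →
      Torus.IsStationaryStatisticalSolution ν f (μbar : Measure H³)

/-- Dyadic Littlewood–Paley block `Δ_j u = P_{2^{j+1}} u − P_{2^j} u`. -/
def dyadicBlock (j : ℕ) (v : 𝕋³ → E³) : 𝕋³ → E³ :=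
  Torus.fourierTruncate (2 ^ (j + 1)) v - Torus.fourierTruncate (2 ^ j) v

/-- Mean cubic flux scale `a_j(μ) = 2^j ∫ ‖Δ_j u‖_{L³}³ dμ` (the CCFS majorant of the energy flux
through `2^j`, averaged). -/
def meanCubicFlux (μ : Measure H³) (j : ℕ) : ℝ≥0∞ :=
  2 ^ j * ∫⁻ u, eLpNorm (dyadicBlock j (u.1 : 𝕋³ → E³)) 3 volume ^ (3 : ℕ) ∂μ

/-- **Onsager in the mean.** If the mean cubic flux scales of a Galerkin limit are finite and tend
to zero (e.g. `∫ ‖u‖³_{B^{1/3}_{3,3}} dμ̄ < ∞`), the mean flux `⟨Π_K⟩ → 0` by CCFS locality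
`|Π_{2^k}| ≲ ∑_j 2^{-2|j-k|/3} 2^j ‖Δ_j u‖₃³`, hence the mean energy equality. -/
def MeanOnsagerCriterion : Prop :=
  ∀ f, IsGoodForce f → ∀ ν : ℝ, 0 < ν → ∀ (R : ℝ) (μs : ℕ → ProbabilityMeasure H³) (μbar : ProbabilityMeasure H³),
    (∀ i, ∃ N, CruxAdmissible f ν R N (μs i : Measure H³)) → Tendsto μs atTop (𝓝 μbar) →
      (∀ j, meanCubicFlux (μbar : Measure H³) j ≠ ∞) →
        Tendsto (meanCubicFlux (μbar : Measure H³)) atTop (𝓝 0) →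
          ν * (Torus.ensembleEnstrophy (μbar : Measure H³)).toReal =
            ∫ u, Torus.pairing u.1 f ∂(μbar : Measure H³)

/-! ## Bracket remark — regularity bridge (not filed as a card) -/

/-- Uniform eventual absorption into a `V`-ball: every global Leray–Hopf solution from energy
`≤ E₀` has `‖∇u(t)‖² ≤ ρ` for `t ≥ T₁(E₀)` (a form of global regularity of forced NS at `(ν, f)`). -/
def UniformEventualAbsorption (ν : ℝ) (f : 𝕋³ → E³) : Prop :=
  ∃ ρ : ℝ≥0∞, ρ < ∞ ∧ ∀ E₀ : ℝ, ∃ T₁ : ℝ, ∀ (u₀ : 𝕋³ → E³) (u : ℝ → 𝕋³ → E³),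
    Torus.IsGlobalLerayHopf ν (fun _ => f) u₀ u → (∫ x, ‖u₀ x‖ ^ 2) ≤ E₀ →
      ∀ t : ℝ, T₁ ≤ t → Torus.eGradNormSq (u t) ≤ ρ

/-- Under uniform eventual absorption, weak–strong Galerkin stability in `V` plus compactness give
an `N`-uniform `H¹` bound on the supports of admissible laws, whence the crux. -/
def BridgeC : Prop :=
  (∀ ν : ℝ, 0 < ν → ∀ f, IsGoodForce f → UniformEventualAbsorption ν f) →
    Summit.AnomalousDissipation.AnomalousDissipation.Theses.MomentParity.ResolvedDissipation

end Summit.AnomalousDissipation.AnomalousDissipation.Cruxes.ResolvedDissipation.Sketch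

end
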